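import Summits.AtomisticToContinuum.FouriersLaw.Theses.HonestZwanzig
import Summits.AtomisticToContinuum.FouriersLaw.Theorems.HonestZwanzigPositiveMemoryUpperLimit
import Summits.AtomisticToContinuum.FouriersLaw.Theorems.HonestZwanzigOrthogonalOhmFeshbachIdentities
import Summits.AtomisticToContinuum.FouriersLaw.Theorems.OddSectorIrreversibilityCorrectorResponseNonneg
import Summits.AtomisticToContinuum.FouriersLaw.Theorems.OddSectorIrreversibilityCorrectorTheoryUniformMixing
import Literature.Barriers.AtomisticToContinuum.FixedLengthNoConductivityControl

/-!
# `HonestZwanzig.OrthogonalOhm` implies the catalogued barrier predicate, by name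
(support / placement file for crux stmt-AtomisticToContinuum-12693, crux-strategist r1, 2026-08-17)

Route `HonestZwanzig` (sub-problem `FouriersLaw` of `AtomisticToContinuum`), crux #2 `OrthogonalOhm`:
N-uniform bounds `|ρ_b| ≤ C` and bulk homogeneity `ρ_b → k` of the zero-frequency orthogonal-dynamics
responses `ρ_b = lim_{s↓0} schur_s(j_b, J)`.

This file makes LITERAL — as implications between ledger declarations — the informal remark "the
boundedness clause contains `HasBoundedResponse`" (crux docstring; disprover's abstract
`conductance_le_of_rowConstancy_backflow_bound`): everything is sorry-free and nothing here asserts a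
route statement.

* `greenKubo_le_of_orthogonalOhm` — `OrthogonalOhm` caps the equilibrium open-chain Green–Kubo integral
  LINEARLY with the crux's own constant: `∫₀^∞ corr_N(J,J) ≤ C · (N - 1)` for every `N ≥ 2`
  (`stub_upperLimit`: `∫₀^∞corr(J,J) ≤ Σ_b ρ_b` at fixed `N`, from the PROVED route item
  `FeshbachIdentities`; then `|ρ_b| ≤ C` on the `N - 1` genuine bonds). In the normalisation of the
  route's conclusion node `MemoryConductivity` this is `T² D_N ≤ C`.
* `greenKubo_linear_of_orthogonalOhm` — the SLOPE is the crux's bulk constant: for every `ε > 0` there is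
  `K` with `∫₀^∞ corr_N(J,J) ≤ N · (k + ε) + K` for all `N ≥ 2`; hence
  `memoryConductivity_le_of_orthogonalOhm`: any limit `k'` of `∫₀^∞corr_N(J,J)/(N-1)` (the `k` of
  `MemoryConductivity`, i.e. `T²κ(T)`) satisfies `k' ≤ k` — the crux alone fixes the conductivity FROM
  ABOVE; the matching lower bound is exactly what `RobinCoercivity` (#4) supplies in `NetworkReduction`
  and positivity what `PositiveMemory` (#3) supplies.
* `boundedResponse_of_orthogonalOhm` — **`OrthogonalOhm → OddSectorIrreversibility.BoundedResponse`**
  (the OPEN shared item stmt-AtomisticToContinuum-10924, wanted by `OddSectorIrreversibility`,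
  `LocalOhmBV`, `MatthiessenLadder`), through the PROVED Kundu–Dhar–Narayan identity
  `OpenChainGreenKubo` (`openChainGreenKubo_holds`), uniqueness of limits along `𝓝[≠] 0`, and
  `0 ≤ D_N` from the PROVED `CorrectorTheory` (`response_nonneg_of_correctorTheory`).
* `hasBoundedResponse_of_orthogonalOhm` — hence, with the PROVED `NessUnique`, for every admissible
  parameter point `HasBoundedResponse (pinnedChain ω₂ lam β γ)`: the crux sits INSIDE the blocked class of
  the catalogued barrier `Literature/Barriers/AtomisticToContinuum/FixedLengthNoConductivityControl.lean`
  ("blocks: `HasBoundedResponse (pinnedChain ω₂ lam β γ)`", Bonetto–Lebowitz–Rey-Bellet 2000 §6.3: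
  "nothing is known about the dependence of `D` on `L`"), head-on.

Placement recorded for the tribunal (D-0033 T1/T4): `BoundedResponse (10924) ⟸ OrthogonalOhm (12693)`
(this file) and `OrthogonalOhm ∧ PositiveMemory ∧ RobinCoercivity ⟹ FouriersLaw` (`Theses.HonestZwanzig.closes`,
landed); the crux is at least the summit's catalogued open core and at most the summit plus a
boundary-layer statement (`Cruxes/OrthogonalOhm/WardDictionary.md` W3, `STRATEGY-CENSUS*.md`).

References: Bonetto–Lebowitz–Rey-Bellet 2000 (arXiv:math-ph/0002052) §6.3; Kundu–Dhar–Narayan 2009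
(arXiv:0809.4543) p. 3; R. Zwanzig, Nonequilibrium Statistical Mechanics (2001) Ch. 8.
-/

noncomputable section

open MeasureTheory Filter Topology Set
open Literature.MathematicalPhysics.KineticTheory.HeatConduction
open Literature.Barriers.AtomisticToContinuum (HasBoundedResponse)
open Summit.AtomisticToContinuum.FouriersLaw.Theses

namespace Summit.AtomisticToContinuum.FouriersLaw.Theorems.HonestZwanzig.OrthogonalOhmPlacement

/-! ### Arithmetic helpers -/

/-- Counting the genuine bonds: `Σ_{b : Fin N} [b+1 < N] · C = C · (N - 1)` for `N ≥ 1`. [folklore] -/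
theorem sum_ite_bond_eq (C : ℝ) {N : ℕ} (hN : 1 ≤ N) :
    (∑ b : Fin N, (if b.val + 1 < N then C else 0)) = C * ((N : ℝ) - 1) := by
  obtain ⟨M, rfl⟩ : ∃ M, N = M + 1 := ⟨N - 1, by omega⟩
  rw [Fin.sum_univ_castSucc]
  have h1 : ∀ i : Fin M, (if (Fin.castSucc i).val + 1 < M + 1 then C else 0) = C := fun i => by
    rw [if_pos]
    rw [Fin.val_castSucc]
    have := i.isLt
    omega
  have h2 : (if (Fin.last M).val + 1 < M + 1 then C else 0) = 0 := by
    rw [if_neg]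
    rw [Fin.val_last]
    omega
  simp only [h1, h2, Finset.sum_const, Finset.card_univ, Fintype.card_fin, add_zero]
  push_cast
  ring

/-- The final division step: `I ≤ C · n`, `n > 0`, `T > 0`, `D = I / (n T²)` give `D ≤ C / T²`. [folklore] -/
theorem div_bound {I C D T n : ℝ} (hT : 0 < T) (hn : 0 < n) (hI : I ≤ C * n)
    (hD : D = I / (n * T ^ 2)) : D ≤ C / T ^ 2 := by
  have hT2 : 0 < T ^ 2 := by positivity
  rw [hD, div_le_div_iff₀ (mul_pos hn hT2) hT2]
  nlinarith

/-- Slopes pass to Cesàro-type limits: if `I_N ≤ N (k + ε) + K_ε` for all `N ≥ 2` and every `ε > 0`, and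
`I_N / (N - 1) → k'`, then `k' ≤ k`. [folklore] -/
theorem limit_le_of_linear_bound (I : ℕ → ℝ) (k k' : ℝ)
    (h : ∀ ε : ℝ, 0 < ε → ∃ K : ℝ, ∀ N : ℕ, 2 ≤ N → I N ≤ (N : ℝ) * (k + ε) + K)
    (hlim : Tendsto (fun N : ℕ => I N / ((N : ℝ) - 1)) atTop (nhds k')) : k' ≤ k := by
  -- compare with the sequence `N (k+ε)/(N-1) + K/(N-1) → k + ε`
  refine le_of_forall_pos_lt_add fun ε hε => ?_
  obtain ⟨K, hK⟩ := h (ε / 2) (half_pos hε)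
  have hup : Tendsto (fun N : ℕ => ((N : ℝ) * (k + ε / 2) + K) / ((N : ℝ) - 1)) atTop (nhds (k + ε / 2)) := by
    have h1 : Tendsto (fun N : ℕ => ((N : ℝ) - 1)⁻¹) atTop (nhds 0) := by
      have : Tendsto (fun N : ℕ => ((N : ℝ) - 1)) atTop atTop :=
        tendsto_atTop_add_const_right _ (-1) tendsto_natCast_atTop_atTop
      exact this.inv_tendsto_atTop
    have hrepr : ∀ᶠ N : ℕ in atTop, ((N : ℝ) * (k + ε / 2) + K) / ((N : ℝ) - 1) =
        (k + ε / 2) + ((k + ε / 2) + K) * ((N : ℝ) - 1)⁻¹ := by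
      filter_upwards [Filter.eventually_ge_atTop 2] with N hN
      have hpos : (0 : ℝ) < (N : ℝ) - 1 := by
        have : (2 : ℝ) ≤ N := by exact_mod_cast hN
        linarith
      field_simp
      ring
    have h2 : Tendsto (fun N : ℕ => (k + ε / 2) + ((k + ε / 2) + K) * ((N : ℝ) - 1)⁻¹) atTop
        (nhds ((k + ε / 2) + ((k + ε / 2) + K) * 0)) :=
      tendsto_const_nhds.add (tendsto_const_nhds.mul h1)
    rw [mul_zero, add_zero] at h2
    exact h2.congr' (hrepr.mono fun N hN => hN.symm)
  have hle : ∀ᶠ N : ℕ in atTop, I N / ((N : ℝ) - 1) ≤ ((N : ℝ) * (k + ε / 2) + K) / ((N : ℝ) - 1) := by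
    filter_upwards [Filter.eventually_ge_atTop 2] with N hN
    have hpos : (0 : ℝ) < (N : ℝ) - 1 := by
      have : (2 : ℝ) ≤ N := by exact_mod_cast hN
      linarith
    exact div_le_div_of_nonneg_right (hK N hN) hpos.le
  have := le_of_tendsto_of_tendsto hlim hup hle
  linarith

/-! ### The Green–Kubo cap -/

/-- **`OrthogonalOhm` caps the open-chain Green–Kubo integral linearly, with its own constant.**  For
`pinnedChain ω₂ lam β γ` (all parameters `> 0`) and `T > 0`, with `C` the constant of the crux (at tolerance
`ε = 1`): `∫₀^∞ corr_N(J,J) ≤ C · (N - 1)` for every `N ≥ 2`, where `corr_N(J,J)(t) = ∫ J·(P_t J) dμ_{N,T} − μ(J)²`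
is the equilibrium autocorrelation of the total current of the `N`-chain with both baths at `T`.
Proof: at fixed `N`, `∫₀^∞corr(J,J) ≤ Σ_b ρ_b` (`PositiveMemory.stub_upperLimit` fed the PROVED item
`FeshbachIdentities`: `Σ_b schur_s(j_b,J) = schur_s(J,J) ≥ lap_s(J,J)` by time reversal and `G(s) ≻ 0`,
then `s ↓ 0`), and `ρ_b ≤ |ρ_b| ≤ C` on the `N − 1` genuine bonds (`ρ := 0` on the phantom index).
[cite: KunduDharNarayan2009, p. 3] -/
theorem greenKubo_le_of_orthogonalOhm (h : HonestZwanzig.OrthogonalOhm) :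
    ∀ ω₂ lam β γ : ℝ, 0 < ω₂ → 0 < lam → 0 < β → 0 < γ → ∀ T : ℝ, 0 < T → ∃ C : ℝ, 0 ≤ C ∧ ∀ N : ℕ, 2 ≤ N →
      let P := Literature.MathematicalPhysics.KineticTheory.HeatConduction.pinnedChain ω₂ lam β γ
      let X := Literature.MathematicalPhysics.KineticTheory.HeatConduction.PhaseSpace N
      let μ : MeasureTheory.Measure X := P.gibbsMeasure N T
      let J : X → ℝ := fun z => ∑ i : Fin N, P.bondCurrent N i z
      (∫ t in Set.Ioi (0 : ℝ), ((∫ z, J z * (∫ y, J y ∂(P.transitionKernel N T T t.toNNReal z)) ∂μ) -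
          (∫ z, J z ∂μ) * (∫ z, J z ∂μ))) ≤ C * ((N : ℝ) - 1) := by
  intro ω₂ lam β γ hω hl hβ hγ T hT
  obtain ⟨k, C, hkC⟩ := h ω₂ lam β γ hω hl hβ hγ T hT
  obtain ⟨R, hR⟩ := hkC 1 one_pos
  -- `0 ≤ C`: there is at least one genuine bond at `N = 2`
  have hC0 : 0 ≤ C := by
    obtain ⟨hb2, -⟩ := hR 2 le_rfl
    obtain ⟨ρ, -, hρC, -⟩ := hb2 ⟨0, by norm_num⟩ (by norm_num)
    exact (abs_nonneg ρ).trans hρC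
  refine ⟨C, hC0, fun N hN => ?_⟩
  intro P X μ J
  obtain ⟨hbonds, -⟩ := hR N hN
  choose ρf hρf using hbonds
  classical
  set ρ : Fin N → ℝ := fun b => if hb : b.val + 1 < N then ρf b hb else 0 with hρdef
  have hρt : ∀ b : Fin N, (hb : b.val + 1 < N) → ρ b = ρf b hb := fun b hb => by
    simp only [hρdef, dif_pos hb]
  have hρ0 : ∀ b : Fin N, ¬ b.val + 1 < N → ρ b = 0 := fun b hb => by
    simp only [hρdef, dif_neg hb]
  -- fixed-`N` upper limit `∫corr(J,J) ≤ Σ_b ρ_b`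
  have hup := PositiveMemory.stub_upperLimit HonestZwanzig.stub_feshbachIdentities
    ω₂ lam β γ hω hl hβ hγ T hT N hN ρ (fun b hb => by rw [hρt b hb]; exact (hρf b hb).1) hρ0
  -- `Σ_b ρ_b ≤ C (N - 1)`
  have hρC : ∀ b : Fin N, ρ b ≤ (if b.val + 1 < N then C else 0) := by
    intro b
    by_cases hb : b.val + 1 < N
    · rw [hρt b hb, if_pos hb]
      exact (le_abs_self _).trans (hρf b hb).2.1
    · rw [hρ0 b hb, if_neg hb]
  have hsum : ∑ b : Fin N, ρ b ≤ C * ((N : ℝ) - 1) := by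
    calc ∑ b : Fin N, ρ b ≤ ∑ b : Fin N, (if b.val + 1 < N then C else 0) :=
          Finset.sum_le_sum fun b _ => hρC b
      _ = C * ((N : ℝ) - 1) := sum_ite_bond_eq C (by omega)
  exact hup.trans hsum

/-- **The slope is the crux's bulk constant `k`.**  With `k, C` the constants of `OrthogonalOhm` at the given
parameters and temperature: for every `ε > 0` there is `K` (namely `(2R(ε)+1)(C+|k|)`) such that
`∫₀^∞ corr_N(J,J) ≤ N · (k + ε) + K` for all `N ≥ 2` — on the bulk bonds `ρ_b ≤ k + ε`, on the at most
`2R+1` others (phantom index included) `|ρ_b − k| ≤ C + |k|`. [cite: KunduDharNarayan2009, p. 3] -/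
theorem greenKubo_linear_of_orthogonalOhm (h : HonestZwanzig.OrthogonalOhm) :
    ∀ ω₂ lam β γ : ℝ, 0 < ω₂ → 0 < lam → 0 < β → 0 < γ → ∀ T : ℝ, 0 < T → ∃ k : ℝ, ∀ ε : ℝ, 0 < ε →
      ∃ K : ℝ, ∀ N : ℕ, 2 ≤ N →
      let P := Literature.MathematicalPhysics.KineticTheory.HeatConduction.pinnedChain ω₂ lam β γ
      let X := Literature.MathematicalPhysics.KineticTheory.HeatConduction.PhaseSpace N
      let μ : MeasureTheory.Measure X := P.gibbsMeasure N T
      let J : X → ℝ := fun z => ∑ i : Fin N, P.bondCurrent N i z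
      (∫ t in Set.Ioi (0 : ℝ), ((∫ z, J z * (∫ y, J y ∂(P.transitionKernel N T T t.toNNReal z)) ∂μ) -
          (∫ z, J z ∂μ) * (∫ z, J z ∂μ))) ≤ (N : ℝ) * (k + ε) + K := by
  intro ω₂ lam β γ hω hl hβ hγ T hT
  obtain ⟨k, C, hkC⟩ := h ω₂ lam β γ hω hl hβ hγ T hT
  refine ⟨k, fun ε hε => ?_⟩
  obtain ⟨R, hR⟩ := hkC ε hε
  have hC0 : 0 ≤ C := by
    obtain ⟨hb2, -⟩ := hR 2 le_rfl
    obtain ⟨ρ, -, hρC, -⟩ := hb2 ⟨0, by norm_num⟩ (by norm_num)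
    exact (abs_nonneg ρ).trans hρC
  refine ⟨(2 * R + 1) * (C + |k|), fun N hN => ?_⟩
  intro P X μ J
  obtain ⟨hbonds, -⟩ := hR N hN
  choose ρf hρf using hbonds
  classical
  set ρ : Fin N → ℝ := fun b => if hb : b.val + 1 < N then ρf b hb else 0 with hρdef
  have hρt : ∀ b : Fin N, (hb : b.val + 1 < N) → ρ b = ρf b hb := fun b hb => by
    simp only [hρdef, dif_pos hb]
  have hρ0 : ∀ b : Fin N, ¬ b.val + 1 < N → ρ b = 0 := fun b hb => by
    simp only [hρdef, dif_neg hb]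
  have hup := PositiveMemory.stub_upperLimit HonestZwanzig.stub_feshbachIdentities
    ω₂ lam β γ hω hl hβ hγ T hT N hN ρ (fun b hb => by rw [hρt b hb]; exact (hρf b hb).1) hρ0
  -- the bulk/boundary dichotomy for `u_b = ρ_b − k`
  have hbulk : ∀ b : Fin N, R ≤ b.val → b.val + 2 + R ≤ N → |ρ b - k| ≤ ε := by
    intro b h1 h2
    have hb : b.val + 1 < N := by omega
    rw [hρt b hb]
    exact (hρf b hb).2.2 h1 h2
  have hall : ∀ b : Fin N, |ρ b - k| ≤ C + |k| := by
    intro b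
    by_cases hb : b.val + 1 < N
    · rw [hρt b hb]
      calc |ρf b hb - k| ≤ |ρf b hb| + |k| := abs_sub _ _
        _ ≤ C + |k| := by linarith [(hρf b hb).2.1]
    · rw [hρ0 b hb, zero_sub, abs_neg]
      linarith [abs_nonneg k]
  have hS := NetworkReduction.sum_abs_le_of_bulk R (fun b => ρ b - k) hε.le (by positivity) hbulk hall
  have hsum : ∑ b : Fin N, ρ b ≤ (N : ℝ) * (k + ε) + (2 * R + 1) * (C + |k|) := by
    have h1 : ∑ b : Fin N, ρ b = (∑ b : Fin N, (ρ b - k)) + (N : ℝ) * k := by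
      rw [Finset.sum_sub_distrib, Finset.sum_const, Finset.card_univ, Fintype.card_fin, nsmul_eq_mul]
      ring
    have h2 : ∑ b : Fin N, (ρ b - k) ≤ ∑ b : Fin N, |ρ b - k| :=
      Finset.sum_le_sum fun b _ => le_abs_self _
    rw [h1]
    nlinarith
  exact hup.trans hsum

/-- **The crux fixes the conductivity from above.**  If `OrthogonalOhm` holds with bulk constant `k` (at given
parameters and `T`) and the normalised Green–Kubo integrals `∫₀^∞corr_N(J,J)/(N−1)` converge to some `k'`
(e.g. the `k = T²κ(T)` of the route's conclusion node `MemoryConductivity`), then `k' ≤ k`.  (Equality is what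
`NetworkReduction` extracts from `RobinCoercivity`; positivity of `k'` is `PositiveMemory`'s content.) [folklore] -/
theorem memoryConductivity_le_of_orthogonalOhm (h : HonestZwanzig.OrthogonalOhm)
    {ω₂ lam β γ : ℝ} (hω : 0 < ω₂) (hl : 0 < lam) (hβ : 0 < β) (hγ : 0 < γ) {T : ℝ} (hT : 0 < T) :
    ∃ k : ℝ, (∀ ε : ℝ, 0 < ε → ∃ R : ℕ, ∀ N : ℕ, 2 ≤ N →
      let P := Literature.MathematicalPhysics.KineticTheory.HeatConduction.pinnedChain ω₂ lam β γ
      let X := Literature.MathematicalPhysics.KineticTheory.HeatConduction.PhaseSpace N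
      let μ : MeasureTheory.Measure X := P.gibbsMeasure N T
      let corr : (X → ℝ) → (X → ℝ) → ℝ → ℝ := fun f g t =>
        (∫ z, f z * (∫ y, g y ∂(P.transitionKernel N T T t.toNNReal z)) ∂μ) - (∫ z, f z ∂μ) * (∫ z, g z ∂μ)
      let lap : ℝ → (X → ℝ) → (X → ℝ) → ℝ := fun s f g => ∫ t in Set.Ioi (0 : ℝ), Real.exp (-(s * t)) * corr f g t
      let e : Fin N → X → ℝ := fun x z => z.2 x ^ 2 / 2 + P.U (z.1 x) +
        ∑ j : Fin N, ((if j.val = x.val + 1 then P.V (z.1 j - z.1 x) / 2 else 0) +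
          (if x.val = j.val + 1 then P.V (z.1 x - z.1 j) / 2 else 0))
      let G : ℝ → Matrix (Fin N) (Fin N) ℝ := fun s => Matrix.of fun x y => lap s (e x) (e y)
      let schur : ℝ → (X → ℝ) → (X → ℝ) → ℝ := fun s f g =>
        lap s f g - ∑ x : Fin N, ∑ y : Fin N, lap s f (e x) * (G s)⁻¹ x y * lap s (e y) g
      let J : X → ℝ := fun z => ∑ i : Fin N, P.bondCurrent N i z
      ∀ b : Fin N, R ≤ b.val → b.val + 2 + R ≤ N → ∀ ρ : ℝ,
        Filter.Tendsto (fun s => schur s (P.bondCurrent N b) J) (nhdsWithin (0 : ℝ) (Set.Ioi 0)) (nhds ρ) →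
          |ρ - k| ≤ ε) ∧
    ∀ k' : ℝ, Filter.Tendsto (fun N : ℕ =>
      (let P := Literature.MathematicalPhysics.KineticTheory.HeatConduction.pinnedChain ω₂ lam β γ
       let X := Literature.MathematicalPhysics.KineticTheory.HeatConduction.PhaseSpace N
       let μ : MeasureTheory.Measure X := P.gibbsMeasure N T
       let J : X → ℝ := fun z => ∑ i : Fin N, P.bondCurrent N i z
       (∫ t in Set.Ioi (0 : ℝ), ((∫ z, J z * (∫ y, J y ∂(P.transitionKernel N T T t.toNNReal z)) ∂μ) -
          (∫ z, J z ∂μ) * (∫ z, J z ∂μ))) / ((N : ℝ) - 1))) Filter.atTop (nhds k') → k' ≤ k := by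
  obtain ⟨k, C, hkC⟩ := h ω₂ lam β γ hω hl hβ hγ T hT
  refine ⟨k, fun ε hε => ?_, fun k' hk' => ?_⟩
  · -- the bulk clause of the crux identifies `k` (uniqueness of limits along `𝓝[>] 0`)
    obtain ⟨R, hR⟩ := hkC ε hε
    refine ⟨R, fun N hN => ?_⟩
    intro P X μ corr lap e G schur J b h1 h2 ρ hρ
    obtain ⟨hbonds, -⟩ := hR N hN
    have hb : b.val + 1 < N := by omega
    obtain ⟨ρ', hρ', -, hbulk⟩ := hbonds b hb
    have heq : ρ = ρ' := tendsto_nhds_unique hρ hρ'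
    rw [heq]
    exact hbulk h1 h2
  · -- the slope bound
    have hlin : ∀ ε : ℝ, 0 < ε → ∃ K : ℝ, ∀ N : ℕ, 2 ≤ N →
        (let P := Literature.MathematicalPhysics.KineticTheory.HeatConduction.pinnedChain ω₂ lam β γ
         let X := Literature.MathematicalPhysics.KineticTheory.HeatConduction.PhaseSpace N
         let μ : MeasureTheory.Measure X := P.gibbsMeasure N T
         let J : X → ℝ := fun z => ∑ i : Fin N, P.bondCurrent N i z
         (∫ t in Set.Ioi (0 : ℝ), ((∫ z, J z * (∫ y, J y ∂(P.transitionKernel N T T t.toNNReal z)) ∂μ) -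
            (∫ z, J z ∂μ) * (∫ z, J z ∂μ)))) ≤ (N : ℝ) * (k + ε) + K := by
      -- re-run the linear bound with THIS `k` (the crux's constants at these parameters)
      intro ε hε
      obtain ⟨R, hR⟩ := hkC ε hε
      have hC0 : 0 ≤ C := by
        obtain ⟨hb2, -⟩ := hR 2 le_rfl
        obtain ⟨ρ, -, hρC, -⟩ := hb2 ⟨0, by norm_num⟩ (by norm_num)
        exact (abs_nonneg ρ).trans hρC
      refine ⟨(2 * R + 1) * (C + |k|), fun N hN => ?_⟩
      obtain ⟨hbonds, -⟩ := hR N hN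
      choose ρf hρf using hbonds
      classical
      set ρ : Fin N → ℝ := fun b => if hb : b.val + 1 < N then ρf b hb else 0 with hρdef
      have hρt : ∀ b : Fin N, (hb : b.val + 1 < N) → ρ b = ρf b hb := fun b hb => by
        simp only [hρdef, dif_pos hb]
      have hρ0 : ∀ b : Fin N, ¬ b.val + 1 < N → ρ b = 0 := fun b hb => by
        simp only [hρdef, dif_neg hb]
      have hup := PositiveMemory.stub_upperLimit HonestZwanzig.stub_feshbachIdentities
        ω₂ lam β γ hω hl hβ hγ T hT N hN ρ (fun b hb => by rw [hρt b hb]; exact (hρf b hb).1) hρ0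
      have hbulk : ∀ b : Fin N, R ≤ b.val → b.val + 2 + R ≤ N → |ρ b - k| ≤ ε := by
        intro b h1 h2
        have hb : b.val + 1 < N := by omega
        rw [hρt b hb]
        exact (hρf b hb).2.2 h1 h2
      have hall : ∀ b : Fin N, |ρ b - k| ≤ C + |k| := by
        intro b
        by_cases hb : b.val + 1 < N
        · rw [hρt b hb]
          calc |ρf b hb - k| ≤ |ρf b hb| + |k| := abs_sub _ _
            _ ≤ C + |k| := by linarith [(hρf b hb).2.1]
        · rw [hρ0 b hb, zero_sub, abs_neg]
          linarith [abs_nonneg k]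
      have hS := NetworkReduction.sum_abs_le_of_bulk R (fun b => ρ b - k) hε.le (by positivity) hbulk hall
      have hsum : ∑ b : Fin N, ρ b ≤ (N : ℝ) * (k + ε) + (2 * R + 1) * (C + |k|) := by
        have h1 : ∑ b : Fin N, ρ b = (∑ b : Fin N, (ρ b - k)) + (N : ℝ) * k := by
          rw [Finset.sum_sub_distrib, Finset.sum_const, Finset.card_univ, Fintype.card_fin, nsmul_eq_mul]
          ring
        have h2 : ∑ b : Fin N, (ρ b - k) ≤ ∑ b : Fin N, |ρ b - k| :=
          Finset.sum_le_sum fun b _ => le_abs_self _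
        rw [h1]
        nlinarith
      exact hup.trans hsum
    exact limit_le_of_linear_bound _ k k' hlin hk'

/-! ### The barrier predicate -/

/-- **`OrthogonalOhm → BoundedResponse` (stmt-AtomisticToContinuum-12693 ⟹ stmt-AtomisticToContinuum-10924).**
Along any steady-state family and at any `T > 0`: for `N ≥ 2` the response coefficient is
`D_N = ∫₀^∞corr_N(J,J)/((N−1)T²)` (the PROVED Kundu–Dhar–Narayan identity `OpenChainGreenKubo`, uniqueness of
limits along `𝓝[≠] 0`), hence `D_N ≤ C/T²` by `greenKubo_le_of_orthogonalOhm`; and `0 ≤ D_N` for every `N` by the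
PROVED corrector calculus (`response_nonneg_of_correctorTheory`). So `(|D_N|)_N` is bounded: the shared open item
`OddSectorIrreversibility.BoundedResponse`. [cite: BonettoLebowitzReyBellet2000, §6.3] -/
theorem boundedResponse_of_orthogonalOhm (h : HonestZwanzig.OrthogonalOhm) :
    OddSectorIrreversibility.BoundedResponse := by
  refine boundedResponse_of_correctorTheory_of_eventually_le
    OddSectorIrreversibility.Corrector.CorrectorTheory_proof ?_
  intro ω₂ lam β γ hω hl hβ hγ hU μ hμ T hT D hD
  obtain ⟨C, -, hC⟩ := greenKubo_le_of_orthogonalOhm h ω₂ lam β γ hω hl hβ hγ T hT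
  refine ⟨C / T ^ 2, Filter.eventually_atTop.2 ⟨2, fun N hN => ?_⟩⟩
  have hGK := (OddSectorIrreversibility.Corrector.openChainGreenKubo_holds ω₂ lam β γ hω hl hβ hγ hU μ hμ T hT N hN).2
  have hpos : (0 : ℝ) < (N : ℝ) - 1 := by
    have : (2 : ℝ) ≤ N := by exact_mod_cast hN
    linarith
  exact div_bound hT hpos (hC N hN) (tendsto_nhds_unique (hD N) hGK)

/-- **`OrthogonalOhm` implies the catalogued barrier predicate at every admissible parameter point**:
`HasBoundedResponse (pinnedChain ω₂ lam β γ)` (`Literature/Barriers/AtomisticToContinuum/FixedLengthNoConductivityControl.lean`,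
"blocks: `HasBoundedResponse (pinnedChain …)`"), the uniqueness hypothesis of `BoundedResponse` being the PROVED shared
item `NessUnique` (stmt-AtomisticToContinuum-0741). The crux therefore sits inside the blocked class of that barrier,
head-on: closing it as typed bounds the finite-size conductivity of the deterministic anharmonic chain uniformly in
the length. [cite: BonettoLebowitzReyBellet2000, §6.3] -/
theorem hasBoundedResponse_of_orthogonalOhm (h : HonestZwanzig.OrthogonalOhm)
    {ω₂ lam β γ : ℝ} (hω : 0 < ω₂) (hl : 0 < lam) (hβ : 0 < β) (hγ : 0 < γ) :
    HasBoundedResponse (pinnedChain ω₂ lam β γ) :=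
  boundedResponse_of_orthogonalOhm h ω₂ lam β γ hω hl hβ hγ (HonestZwanzig.NessUnique_holds ω₂ lam β γ hω hl hβ hγ)

end Summit.AtomisticToContinuum.FouriersLaw.Theorems.HonestZwanzig.OrthogonalOhmPlacement

namespace Summit.AtomisticToContinuum.FouriersLaw.Theorems.HonestZwanzig

/-- **Registered sub-goal of crux stmt-AtomisticToContinuum-12693** (`helper_boundedResponse_of_orthogonalOhm`,
crux-strategist r1): the crux `OrthogonalOhm` implies the shared open item `OddSectorIrreversibility.BoundedResponse`
(stmt-AtomisticToContinuum-10924) — the catalogued barrier predicate `HasBoundedResponse (pinnedChain …)` under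
weak-NESS uniqueness.  Alias of `OrthogonalOhmPlacement.boundedResponse_of_orthogonalOhm`.
[cite: BonettoLebowitzReyBellet2000, §6.3] -/
theorem helper_boundedResponse_of_orthogonalOhm : Summit.AtomisticToContinuum.FouriersLaw.Theses.HonestZwanzig.OrthogonalOhm → Summit.AtomisticToContinuum.FouriersLaw.Theses.OddSectorIrreversibility.BoundedResponse :=
  OrthogonalOhmPlacement.boundedResponse_of_orthogonalOhm

end Summit.AtomisticToContinuum.FouriersLaw.Theorems.HonestZwanzig

end
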